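import Mathlib
import Literature.NumberTheory.LFunctions.WeilOddGroundState
import Summits.RiemannHypothesis.RiemannHypothesis.Theorems.WeilParityEvenWinsBeyondArchFrontier67
import Summits.RiemannHypothesis.RiemannHypothesis.Theorems.WeilGroundStateGroundStateSimpleEvenTrialUpperH
import Summits.RiemannHypothesis.RiemannHypothesis.Theorems.WeilGroundStateGroundStateSimpleEvenCellTransfer
import HarnessLib

/-!
# The parity ladder beyond `log 2`: the window `(0, 18/25]` from ONE odd-sector lower bound at `18/25`

Route WeilParity item `NoParityCrossing` (stmt-RiemannHypothesis-18085; stub `stub_tailSimpleEven`, first bite) ≡ GroundBarta rung 4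
(`EvenWinsBeyondArch`, stmt-RiemannHypothesis-18807).  Pure logic, RH-free, no named facts.

The frontier of the certified clause `WeilWindowSimpleEven` (ground state simple, isolated, even) stands at `2/3`
(`EvenWinsBeyondArch.weilWindowSimpleEven_of_le_two_thirds`, Frontier67) and the cell transfer
`GroundStateSimpleEven.weilWindowSimpleEven_on_cell_of_le` needs, for the cell `[2/3, 18/25]` — which CROSSES `log 2`
(the prime power `4` enters) — the landed U-side `trialUpperH : ε(2/3) ≤ 10⁻¹¹` and an L-side `L ≤ ε_od(18/25)` with
`L > 10⁻¹¹`.  This file isolates that single remaining input: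

* `weilWindowSimpleEven_on_cell_M72_of_oddLower`, **`weilWindowSimpleEven_of_le_M72_of_oddLower`**:
  `10⁻¹¹ < L ≤ ε_od(18/25) ⟹ WeilWindowSimpleEven a` for every `0 < a ≤ 18/25`;
* `tailSimpleEven_upTo_M72_of_oddLower`: the same on `(log 2, 18/25]` (the shape of `stub_tailSimpleEven`).

The L-side is the deflated Temple / Lehmann–Maehly bound (`EvenWinsBeyondArch.dt_weilOddGroundEnergy_ge_of_ritz`) fed by the
rank-one augmented two-prime certificate at `a₀ = 18/25` (`Literature/…/WeilTwoPrimeDeflM72*`, `β₂₃ = 17/25`), the sliver bound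
(`weilTwoPrimeQuadratic_sub_le_weilQuadratic_re`, `β = 17/25 − (log 2)/2`) and the `6 × 6` PSD datum of its six penalty vectors;
numerically `ε_od(18/25) ≈ 4.45·10⁻¹¹`.
-/

set_option linter.dupNamespace false

noncomputable section

open Set MeasureTheory

namespace Summit.RiemannHypothesis.RiemannHypothesis.Theorems.EvenWinsBeyondArch

open Literature.NumberTheory.LFunctions

/-- **The cell `[2/3, 18/25]` from an odd-sector lower bound at `18/25`.** If `10⁻¹¹ < L ≤ ε_od(18/25)` then
`WeilWindowSimpleEven a` for every `a ∈ [2/3, 18/25]` (U-side `trialUpperH`, L-side `ε_od(18/25) ≤ Re Q(g)` for normalised odd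
window tests, `weilOddGroundEnergy_le`). [folklore] -/
theorem weilWindowSimpleEven_on_cell_M72_of_oddLower {L : ℝ} (hUL : (1 / 100000000000 : ℝ) < L)
    (hL : L ≤ weilOddGroundEnergy (18 / 25 : ℝ)) {a : ℝ} (hlo : (2 / 3 : ℝ) ≤ a) (hhi : a ≤ 18 / 25) :
    WeilWindowSimpleEven a :=
  GroundStateSimpleEven.weilWindowSimpleEven_on_cell_of_le (b := (2 / 3 : ℝ)) (c := (18 / 25 : ℝ)) (by norm_num) hUL
    trialUpperH (fun _ hg hs hn ho ↦ hL.trans (weilOddGroundEnergy_le hg hs ho hn)) hlo hhi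

/-- **`WeilWindowSimpleEven` on `(0, 18/25]` from an odd-sector lower bound at `18/25`** (Frontier67 + the cell above). [folklore] -/
theorem weilWindowSimpleEven_of_le_M72_of_oddLower {L : ℝ} (hUL : (1 / 100000000000 : ℝ) < L)
    (hL : L ≤ weilOddGroundEnergy (18 / 25 : ℝ)) :
    ∀ a : ℝ, 0 < a → a ≤ 18 / 25 → WeilWindowSimpleEven a := by
  intro a ha hle
  rcases le_or_gt a (2 / 3) with h | h
  · exact weilWindowSimpleEven_of_le_two_thirds a ha h
  · exact weilWindowSimpleEven_on_cell_M72_of_oddLower hUL hL h.le hle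

/-- **Strict parity order on `(0, 18/25]`** from the odd-sector lower bound: `ε_ev(a) < ε_od(a)`. [folklore] -/
theorem weilEvenGroundEnergy_lt_weilOddGroundEnergy_of_le_M72_of_oddLower {L : ℝ} (hUL : (1 / 100000000000 : ℝ) < L)
    (hL : L ≤ weilOddGroundEnergy (18 / 25 : ℝ)) {a : ℝ} (ha : 0 < a) (hhi : a ≤ 18 / 25) :
    weilEvenGroundEnergy a < weilOddGroundEnergy a :=
  (weilWindowSimpleEven_iff_weilEvenGroundEnergy_lt ha).1 (weilWindowSimpleEven_of_le_M72_of_oddLower hUL hL a ha hhi)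

/-- **The first bite of the tail** (shape of `stub_tailSimpleEven` of item 18085, restricted to `a ≤ 18/25`): from the odd-sector
lower bound at `18/25`, `WeilWindowSimpleEven a` for `log 2 < a ≤ 18/25`. [folklore] -/
theorem tailSimpleEven_upTo_M72_of_oddLower {L : ℝ} (hUL : (1 / 100000000000 : ℝ) < L)
    (hL : L ≤ weilOddGroundEnergy (18 / 25 : ℝ)) :
    ∀ a : ℝ, Real.log 2 < a → a ≤ 18 / 25 → WeilWindowSimpleEven a :=
  fun a ha hle ↦ weilWindowSimpleEven_of_le_M72_of_oddLower hUL hL a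
    (lt_trans (Real.log_pos (by norm_num)) ha) hle

end Summit.RiemannHypothesis.RiemannHypothesis.Theorems.EvenWinsBeyondArch

end
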